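import Summits.Ventures.YMGap.YM3IR.BalabanSUN
import Summits.Ventures.YMGap.RobustBall.StarRowsSU3PVDim3
import HarnessLib

/-!
# YM3IR / BalabanCeilingsSU3PV — the §Y4 sentence for `SU(3)` on engine-2's HYPOTHESIS-FREE PV-star rows (Wilson `β_W = 2/5`
and `β_W = 12/25`), with the counted crossover (theorems only; no new conjecture name)

HONEST FRAMING (cell pub-ymgap, track Y4 / YM3-IR, seat ym3ir-theory-1, gen 10; follow-up to `YM3IR/BalabanCeilingsSU3.lean`, written
once engine-2 (g9)'s `RobustBall/StarRowsSU3PVDim3.lean` (the `d = 3` cells of `StarRowsSU3PV`, ds-2's robust vertex-star doors on the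
hypothesis-free Poincaré × Schwinger–Dyson modulus `OneLinkVarianceSD.oneLinkKRModulus_pv`) is in the tree, per R212 (iii)).  This file
claims NO summit, NO mass gap and NO part of Bałaban's theorems.
It is kernel-checked BOOKKEEPING: `BalabanSUN.massGap3Cofinal_suN_balaban_of_irConjecture3` at `N = 3` with track Y2's input
(`ClusterDomainClustering`) DISCHARGED BY NAME by engine-2's hypothesis-free `SU(3)` PV-star rows:
`RobustBall.su3_clusterDomainClustering_dim3_pvStar_twelveTwentyFifths r` (tree ceiling `4/25` = Wilson `12/25`, ball
`ClusterDomainFR (3/500) (3/1000) r` — the highest hypothesis-free `SU(3)` `d = 3` ceiling in the tree; radius a door artefact) and the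
working row `RobustBall.su3_clusterDomainClustering_dim3_pvStar_twoFifths r` (tree ceiling `2/15` = Wilson `2/5`, ball
`ClusterDomainFR (2/25) (1/25) r`).  WHAT MOVES on the UV side: the hypothesis-free `SU(3)` receiving end of the §Y4 sentence rises from
Wilson `1/3` (`BalabanCeilingsSU3`, ds-2's `K₁`-star row) to `12/25`; the CERTIFIED rows GIVEN H1, H2 (`BalabanCeilingsSU3Certified`,
Wilson `33/40`) are untouched and remain higher.  Lattice statements only; strong-coupling constants; no continuum limit, no Millennium
claim; no axiom, no `sorry`, no `def`; `0` compute.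

THE HYPOTHESIS LIST, VERBATIM (`massGap3Cofinal_su3_balaban_pvStar_twelveTwentyFifths_of_irConjecture3`): `BalabanUV3 mk` — IN PRINT
(Bałaban, CMP 102 (1985), Thm 1 p. 257 + Thm 2 p. 272), EVIDENTIAL (theory-2 F2: the kernel arrow does not consume it);
`Nonempty (Family L eps0)` — print's clauses at one coupling (p. 256 L15–18); `0 < C_b`, `0 < κ`;
`IRConjecture3 (ballOfRobustBallFR 3 (3/500) (3/1000) r (4/25)) suFrobDist (fundamentalRep (Fin 3)) (balabanCouplings L (suGroupModel 3)
eps0) C_b κ` — the ONE CONJECTURE of record (theory-2, `YM3IR/Statement.lean`; NOT in print).  LABEL OF RECORD (R196, verbatim): with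
existential `(C_b, κ)` this is a typed INTERFACE, a «dictionary, not a reduction» (forest witness, `YM3IR/ForestWitnessSUN.lean`).
CONCLUSION: `MassGap3Cofinal (balabanCouplings L (suGroupModel 3) eps0) suFrobDist (fundamentalRep (Fin 3))`.

COUNTED CROSSOVER (PROVED arithmetic, tree units `β = β_W/3`): below the ceiling `4/25` after `K + M'` steps iff `L^{M'} ≥ 25/(12γ₀²)`
(`su3_betaTree_div_pow_le_4_25_iff`; `≥ 25/12` with `γ₀² ≤ 1`), vs `3/γ₀²` at `1/9` (`BalabanCeilingsSU3.su3_betaTree_div_pow_le_ninth_iff`)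
and `40/(33γ₀²)` at the certified `11/40` (`BalabanCeilingsSU3Certified.su3_betaTree_div_pow_le_11_40_iff`).

WHY THIS IS NOVEL (one sentence).  The `SU(3)` — physical colour group — instance of «print + certified strong-coupling expansion + ONE
named conjecture ⟹ lattice YM₃ mass gap on Bałaban's coupling set» with Y2's input a HYPOTHESIS-FREE theorem up to Wilson `β_W = 12/25`
and its explicit crossover count `L^{M'} ≥ 25/(12γ₀²)`.

References: T. Bałaban, CMP 102 (1985) 255–275, p. 256 L15–18, (5) p. 256, Thm 1 p. 257, Thm 2 p. 272 [cite: Balaban1985UV3];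
H. Shen, R. Zhu, X. Zhu, CMP 400 (2023) (the vertex σ-model dictionary behind the star rows; engine-2's file header).
-/

noncomputable section

open MeasureTheory
open Literature.MathematicalPhysics.QuantumLattice Literature.MathematicalPhysics.QuantumFieldTheory
open Balaban1985CMP102 Balaban1985CMP102.Setting Balaban1985CMP102.Theorems
open Literature.MathematicalPhysics.QuantumFieldTheory.Balaban1983to89 (GaugeGroup HaarData)
open Summit.QuantumFields.Balaban3D.Carriers (suGroupModel)

namespace Summit.Ventures.YMGap.YM3IR

open CarrierBridge

/-- **`SU(3)` lattice YM₃ mass gap on Bałaban's coupling set, receiving at Wilson `β_W = 12/25`, Y2's input HYPOTHESIS-FREE (PROVED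
bookkeeping).**  engine-2's PV-star row `RobustBall.su3_clusterDomainClustering_dim3_pvStar_twelveTwentyFifths r` BY NAME (tree ceiling
`4/25`, ball `ClusterDomainFR (3/500) (3/1000) r`, some rate `m > 0`).  EXACTLY ONE hypothesis is neither in print nor certified:
`IRConjecture3` (label of record R196: with existential `(C_b, κ)` a typed interface — a dictionary, not a reduction).
[cite: Balaban1985UV3, Thm 1 p.257; Thm 2 p.272] -/
theorem massGap3Cofinal_su3_balaban_pvStar_twelveTwentyFifths_of_irConjecture3 {L : ℕ} {mk : Construction L} {eps0 : ℝ → ℝ}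
    (hfam : Nonempty (Family L eps0)) (r : ℕ) {C_b κ : ℝ} (hC : 0 < C_b) (hκ : 0 < κ) (hUV : BalabanUV3 mk)
    (hIR : IRConjecture3 (ballOfRobustBallFR 3 (3 / 500) (3 / 1000) r (4 / 25)) suFrobDist (fundamentalRep (Fin 3))
      (balabanCouplings L (suGroupModel 3) eps0) C_b κ) :
    MassGap3Cofinal (balabanCouplings L (suGroupModel 3) eps0) suFrobDist
      (fundamentalRep (Fin 3) : RobustBall.SUN 3 →* Matrix (Fin 3) (Fin 3) ℂ) := by
  obtain ⟨m, hm, hRB, -⟩ := RobustBall.su3_clusterDomainClustering_dim3_pvStar_twelveTwentyFifths r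
  exact massGap3Cofinal_suN_balaban_of_irConjecture3 hfam hC hκ hm hUV hRB hIR

/-- **The same at Wilson `β_W = 2/5` (tree ceiling `2/15`), Y2's input HYPOTHESIS-FREE on the larger working ball (PROVED
bookkeeping):** engine-2's `RobustBall.su3_clusterDomainClustering_dim3_pvStar_twoFifths r` (ball `ClusterDomainFR (2/25) (1/25) r`);
the ONE non-printed, non-certified hypothesis is `IRConjecture3` (label of record R196: with existential `(C_b, κ)` a dictionary, not a
reduction). [cite: Balaban1985UV3, Thm 1 p.257; Thm 2 p.272] -/
theorem massGap3Cofinal_su3_balaban_pvStar_twoFifths_of_irConjecture3 {L : ℕ} {mk : Construction L} {eps0 : ℝ → ℝ}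
    (hfam : Nonempty (Family L eps0)) (r : ℕ) {C_b κ : ℝ} (hC : 0 < C_b) (hκ : 0 < κ) (hUV : BalabanUV3 mk)
    (hIR : IRConjecture3 (ballOfRobustBallFR 3 (2 / 25) (1 / 25) r (2 / 15)) suFrobDist (fundamentalRep (Fin 3))
      (balabanCouplings L (suGroupModel 3) eps0) C_b κ) :
    MassGap3Cofinal (balabanCouplings L (suGroupModel 3) eps0) suFrobDist
      (fundamentalRep (Fin 3) : RobustBall.SUN 3 →* Matrix (Fin 3) (Fin 3) ℂ) := by
  obtain ⟨m, hm, hRB, -⟩ := RobustBall.su3_clusterDomainClustering_dim3_pvStar_twoFifths r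
  exact massGap3Cofinal_suN_balaban_of_irConjecture3 hfam hC hκ hm hUV hRB hIR

/-- **In PRINT'S quantifier order at `β_W = 12/25` (PROVED bookkeeping):** `∃ eps0` first (print, p. 256 L15–18), then for every `r`,
`C_b`, `κ`: `IRConjecture3` on the row's ball (label of record R196: a dictionary, not a reduction) ⟹ `MassGap3Cofinal`.
[cite: Balaban1985UV3, p.256 L15–18; Thm 2 p.272] -/
theorem massGap3Cofinal_su3_balaban_pvStar_twelveTwentyFifths_printedOrder_of_irConjecture3 {L : ℕ} (mk : Construction L)
    (hUV : BalabanUV3 mk) :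
    ∃ eps0 : ℝ → ℝ, (∀ g : ℝ, 0 < g → 0 < eps0 g) ∧
      (∀ S : Family L eps0, ∀ k, k ≤ S.1.K → (mk (RobustBall.SUN 3) (suGroupModel 3) S.1).ineq41_47 k) ∧
      ∀ (r : ℕ) (C_b κ : ℝ), 0 < C_b → 0 < κ → Nonempty (Family L eps0) →
        IRConjecture3 (ballOfRobustBallFR 3 (3 / 500) (3 / 1000) r (4 / 25)) suFrobDist (fundamentalRep (Fin 3))
          (balabanCouplings L (suGroupModel 3) eps0) C_b κ →
          MassGap3Cofinal (balabanCouplings L (suGroupModel 3) eps0) suFrobDist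
            (fundamentalRep (Fin 3) : RobustBall.SUN 3 →* Matrix (Fin 3) (Fin 3) ℂ) := by
  obtain ⟨eps0, hpos, h2, h⟩ := massGap3Cofinal_suN_balaban_printedOrder_of_irConjecture3 (N := 3) mk hUV
  refine ⟨eps0, hpos, h2, fun r C_b κ hC hκ hfam hIR => ?_⟩
  obtain ⟨m, hm, hRB, -⟩ := RobustBall.su3_clusterDomainClustering_dim3_pvStar_twelveTwentyFifths r
  exact h (ballOfRobustBallFR 3 (3 / 500) (3 / 1000) r (4 / 25)) C_b κ m hC hκ hm hfam hRB hIR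

/-- **`SU(3)` at the hypothesis-free ceiling `β⋆ = 4/25` (`β_W = 12/25`; PROVED arithmetic):** a member's coupling after `K + M'` steps is
below `4/25` iff `L^{M'} ≥ 25/(12γ₀²)`. [cite: Balaban1985UV3, (5) p.256] -/
theorem su3_betaTree_div_pow_le_4_25_iff {L : ℕ} (S : Scales L) (M' : ℕ) :
    betaTree (suGroupModel 3) S / (L : ℝ) ^ (S.K + M') ≤ 4 / 25 ↔ 25 / (12 * Dictionary.gammaSq S) ≤ (L : ℝ) ^ M' := by
  rw [suN_betaTree_div_pow_le_iff S M' (by norm_num : (0 : ℝ) < 4 / 25)]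
  have e : (((3 : ℕ) : ℝ) * Dictionary.gammaSq S * (4 / 25))⁻¹ = 25 / (12 * Dictionary.gammaSq S) := by
    have e1 : ((3 : ℕ) : ℝ) * Dictionary.gammaSq S * (4 / 25) = 12 * Dictionary.gammaSq S / 25 := by
      push_cast
      ring
    rw [e1, inv_div]
  rw [e]

/-- Hence at `β⋆ = 4/25` for `SU(3)` (PROVED arithmetic; `γ₀² ≤ 1`): in the window after `K + M'` steps forces `25/12 ≤ L^{M'}`.
[cite: Balaban1985UV3, (5) p.256] -/
theorem su3_twentyFiveTwelfths_le_pow_of_betaTree_div_pow_le_4_25 {L : ℕ} (S : Scales L) (M' : ℕ)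
    (h : betaTree (suGroupModel 3) S / (L : ℝ) ^ (S.K + M') ≤ 4 / 25) : (25 / 12 : ℝ) ≤ (L : ℝ) ^ M' := by
  have hγ : 0 < Dictionary.gammaSq S := Dictionary.gammaSq_pos S
  have hγ1 : Dictionary.gammaSq S ≤ 1 := Dictionary.gammaSq_le_one S
  have h3 : 25 / (12 * Dictionary.gammaSq S) ≤ (L : ℝ) ^ M' := (su3_betaTree_div_pow_le_4_25_iff S M').1 h
  have h33 : (25 / 12 : ℝ) ≤ 25 / (12 * Dictionary.gammaSq S) := by
    rw [le_div_iff₀ (by positivity)]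
    nlinarith
  exact h33.trans h3

/-- **The conjecture's counted task on the `SU(3)` `β_W = 12/25` row (PROVED arithmetic), at the row's ball for the record.**
[cite: Balaban1985UV3, (5) p.256] -/
theorem su3_row_pvStar_twelveTwentyFifths_crossover_steps {L : ℕ} (S : Scales L) (M' : ℕ)
    (h : betaTree (suGroupModel 3) S / (L : ℝ) ^ (S.K + M') ≤
      (ballOfRobustBallFR 3 (3 / 500) (3 / 1000) 0 (4 / 25)).βstar) :
    (25 / 12 : ℝ) ≤ (L : ℝ) ^ M' :=
  su3_twentyFiveTwelfths_le_pow_of_betaTree_div_pow_le_4_25 S M' h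

end Summit.Ventures.YMGap.YM3IR

end
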